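import Summits.HodgeConjecture.HodgeConjecture.Theorems.Ring2AbelianAllAndreSpreadNumerical
import HarnessLib

/-!
# Ring 2 · sub-cell AbelianAll (ALL ABELIAN VARIETIES), André axis, part XIX-e — PENCIL BY PENCIL: on ONE CM-pointed
# compact pencil of abelian varieties, granted `HC_CM` and the classical spreading (`SpreadCurve[]`), **conjecture D
# for the cycles of the total space supported on the CM fibre ⟺ the lift at the CM fibre ⟺ every invariant Hodge
# class is algebraic on EVERY fibre ⟺ Abdulali's transport (1.1)_f** — the node-level exactness of parts XVIII-c /
# XIX-a / XIX-b read on a single pencil (the form in which habitat rows, e.g. the Weil-sixfold pencils, consume it)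

HONEST FRAMING (page 1, verbatim): **research route, not a corollary; conditional on HC_CM plus one named
minimal statement.** Cell line: research route conditional on HC_CM; not a corollary; Q11.4-sentence-2 already
refuted in dim ≥ 3. Nothing in this file proves a case of the Hodge conjecture for an abelian variety; `HC_CM` and
`SpreadCurve[]` are BINDERS; the reduction item `CMToAbelian` (stmt-HodgeConjecture-16267) is NOT closed here.

## Content (one pencil `f : 𝒳 ⟶ S` of abelian `d`-folds, one point `t`)

Four statements about `(f, t)`:
* (Num_{f,t}) `∀ p + q = d`, every algebraic class `j_{t*} b` (`b ∈ N^q(𝒳_t)`) cup-orthogonal to `N^p(𝒳)` is zero;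
* (L_{f,t}) `∀ p`, `(j_t^*)⁻¹ N^p(𝒳_t) ≤ N^p(𝒳) ⊔ ker j_t^*` (the lift at `t`, lattice form of part XVII-b);
* (IHC_f) every global class with rational `(p,p)` fibre restrictions is algebraic on EVERY fibre (no anchor);
* (1.1)_f `Abdulali1994.InvariantCyclesHoldFor f d` (the same, granted algebraicity on ONE fibre).
Edges: (IHC_f) ⟹ (1.1)_f trivially; at a CM point under `HC_CM`, (1.1)_f ⟹ (IHC_f) (the CM fibre is an anchor:
`Ring2Transport.mem_algebraicClasses_of_cmChart`) and (L_{f,t}) ⟹ (IHC_f) (`W = η + κ`, `κ` dies on every fibre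
since `ker j_s^*` does not depend on `s`); granted `SpreadCurve[]`, (IHC_f) ⟹ (L_{f,t}) at EVERY `t` (part XIX-a's
engine after part XVII-b's reduction to rational classes); and (Num_{f,t}) ⟺ (L_{f,t}) at a CM point under `HC_CM`
(part XVIII-c). Hence **at a CM point, granted `HC_CM` and `SpreadCurve[]`: (Num_{f,t}) ⟺ (L_{f,t}) ⟺ (IHC_f) ⟺
(1.1)_f** (`numerical_iff_invariantCyclesHoldFor_of_HC_CM` and companions). READING (RING2-MAP AA2.90 made
kernel, pencil by pencil): "find, for each algebraic `b` on the CM fibre with `j_{t*}b ≠ 0`, ONE algebraic cycle of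
the `(d+1)`-fold detecting it" is the same problem as "show the invariant Hodge classes algebraic on every fibre of
this pencil" — on a CM-pointed pencil of Weil-type sixfolds, the algebraicity of the Weil classes on its non-CM
members. Part XIX-c's `comap_le_sup_of_hcAtDim` is the special case (IHC_f) ⟸ `HCAtDim d`.

EDGE LABELS: K (§1 items without `hSp`), K[SpreadCurve] (the rest); `HC_CM` a binder. No `def`, no `sorry`; axioms
standard.

References: Abdulali1994FamiliesAV ((1.1) p. 1122, Lemma 6.2 p. 1131); Andre1996Motifs (§5.1 (A3)–(A4) p. 25, §6.3
p. 33); Kleiman1968AlgebraicCycles (§3, D(X)); Milne2020HodgeClassesAV (Prop. 1 p. 7); VoisinHodgeII2003 (§3.3.1,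
proof of Thm. 10.19); CharlesSchnell2014Notes (Prop. 11.3.5, Prop. 11.3.11).
-/

noncomputable section

set_option linter.dupNamespace false

namespace Summit.HodgeConjecture.HodgeConjecture.Ring2.AbelianAll

open CategoryTheory AlgebraicGeometry
open Literature.AlgebraicGeometry Literature.AlgebraicGeometry.Motives
open Literature.AlgebraicGeometry.HodgeTheory
open Literature.AlgebraicTopology.SingularHomology (cupProduct)
open Literature.AlgebraicGeometry.Abdulali1994 (InvariantCyclesHoldFor)
open Literature.AlgebraicGeometry.Deligne1982 (cmLocus)
open Summit.HodgeConjecture.HodgeConjecture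
open Summit.HodgeConjecture.HodgeConjecture.Theses

variable {𝒳 S : SchemeOver ℂ}

/-- `SpreadCurve[]` — part XIX-a's hypothesis shape (VERBATIM the body of the Literature named fact
`HodgeTheory.spread_algebraicClasses_over_smoothCurve`). NOT vendored: no definition is made here.
[cite: VoisinHodgeII2003, §3.3.1 and §10.2.1, proof of Thm. 10.19] [cite: CharlesSchnell2014Notes, Prop. 11.3.11 (proof)] -/
local notation3 (prettyPrint := false) "SpreadCurve[]" =>
  ∀ ⦃d q : ℕ⦄ ⦃T W : SchemeOver ℂ⦄ (f : W ⟶ T),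
    SmoothOfRelativeDimension 1 T.hom → IrreducibleSpace T.left → IsQuasiProjectiveOver W →
    Flat f.left → IsProper f.left → 1 ≤ q → q ≤ d →
    ∀ S : Set T.left, IsClosed S → S ≠ Set.univ →
      (∀ t : ComplexPoints T, t.pt ∉ S → IsSmoothProjective d (fiberOver f t)) →
      ∀ c : complexBetti W (2 * q), IsRationalClass c →
        (∀ t : ComplexPoints T, t.pt ∉ S →
          complexBetti.map (fiberι f t) (2 * q) c ∈ algebraicClasses (fiberOver f t) q) →
        ∃ a : complexBetti W (2 * q), a ∈ algebraicClasses W q ∧ IsRationalClass a ∧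
          ∃ S' : Set T.left, IsClosed S' ∧ S ⊆ S' ∧ S' ≠ Set.univ ∧
            ∀ t : ComplexPoints T, t.pt ∉ S' →
              complexBetti.map (fiberι f t) (2 * q) (c - a) = 0

/-! ## §1 (IHC_f): invariant Hodge classes algebraic on every fibre — versus (1.1)_f and the lift -/

/-- **(IHC_f) ⟹ (1.1)_f** (forget the anchor). [cite: Abdulali1994FamiliesAV, (1.1) (p. 1122)] -/
theorem invariantCyclesHoldFor_of_forall_mem_algebraicClasses {d : ℕ} {f : 𝒳 ⟶ S}
    (h : ∀ (p : ℕ) (W : complexBetti 𝒳 (2 * p)),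
      (∀ s : ComplexPoints S, IsRationalClass (complexBetti.map (fiberι f s) (2 * p) W) ∧
        IsOfHodgeType d (fiberOver f s) (2 * p) p p (complexBetti.map (fiberι f s) (2 * p) W)) →
      ∀ s : ComplexPoints S, complexBetti.map (fiberι f s) (2 * p) W ∈ algebraicClasses (fiberOver f s) p) :
    InvariantCyclesHoldFor f d :=
  fun p W hW _ s ↦ h p W hW s

/-- **At a CM point, granted `HC_CM`: (1.1)_f ⟹ (IHC_f)** — the CM fibre is an algebraic anchor for every global
class with rational `(p,p)` fibre restrictions (`Ring2Transport.mem_algebraicClasses_of_cmChart`). `HC_CM` a BINDER.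
[cite: Abdulali1994FamiliesAV, Lemma 6.2 (p. 1131)] [cite: Andre1996Motifs, §6.3 a) (p. 33)] -/
theorem forall_mem_algebraicClasses_of_invariantCyclesHoldFor_of_HC_CM (hCM : RankFourFaces.CMAbelianHodge)
    {d : ℕ} {f : 𝒳 ⟶ S} {t : ComplexPoints S} (ht : t ∈ cmLocus f d) (hT : InvariantCyclesHoldFor f d)
    (p : ℕ) (W : complexBetti 𝒳 (2 * p))
    (hW : ∀ s : ComplexPoints S, IsRationalClass (complexBetti.map (fiberι f s) (2 * p) W) ∧
      IsOfHodgeType d (fiberOver f s) (2 * p) p p (complexBetti.map (fiberι f s) (2 * p) W))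
    (s : ComplexPoints S) :
    complexBetti.map (fiberι f s) (2 * p) W ∈ algebraicClasses (fiberOver f s) p := by
  obtain ⟨A₀, ⟨e₀⟩, hdim, hcm⟩ := ht
  exact hT p W hW ⟨t, Ring2Transport.mem_algebraicClasses_of_cmChart hCM A₀ e₀ hdim hcm (hW t).1 (hW t).2⟩ s

/-- **The lift at one point ⟹ (IHC_f), at a CM point granted `HC_CM`** (no spreading): for `W` with rational `(p,p)`
fibre restrictions, `j_t^* W` is algebraic on the CM fibre, so `W = η + κ` with `η ∈ N^p(𝒳)` and `j_t^* κ = 0`; the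
kernel of `j_s^*` does not depend on `s` (part X-c, `map_fiberι_eq_zero_of_eq_zero`), so `j_s^* W = j_s^* η` is
algebraic (restriction of algebraic classes, `map_fiberι_mem_algebraicClasses`). `HC_CM` a BINDER.
[cite: Andre1996Motifs, §5.1 (A3)–(A4) (p. 25)] [cite: Milne2020HodgeClassesAV, Prop. 1 (p. 7)] -/
theorem forall_mem_algebraicClasses_of_comap_le_sup_of_HC_CM (hCM : RankFourFaces.CMAbelianHodge) {d : ℕ}
    {f : 𝒳 ⟶ S} (hf : IsCompactAbelianPencil f d) {t : ComplexPoints S} (ht : t ∈ cmLocus f d)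
    (hL : ∀ p : ℕ, (algebraicClasses (fiberOver f t) p).comap (complexBetti.map (fiberι f t) (2 * p)).hom ≤
      algebraicClasses 𝒳 p ⊔ LinearMap.ker (complexBetti.map (fiberι f t) (2 * p)).hom)
    (p : ℕ) (W : complexBetti 𝒳 (2 * p))
    (hW : ∀ s : ComplexPoints S, IsRationalClass (complexBetti.map (fiberι f s) (2 * p) W) ∧
      IsOfHodgeType d (fiberOver f s) (2 * p) p p (complexBetti.map (fiberι f s) (2 * p) W))
    (s : ComplexPoints S) :
    complexBetti.map (fiberι f s) (2 * p) W ∈ algebraicClasses (fiberOver f s) p := by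
  obtain ⟨A₀, ⟨e₀⟩, hdim, hcm⟩ := ht
  have hWt : complexBetti.map (fiberι f t) (2 * p) W ∈ algebraicClasses (fiberOver f t) p :=
    Ring2Transport.mem_algebraicClasses_of_cmChart hCM A₀ e₀ hdim hcm (hW t).1 (hW t).2
  obtain ⟨η, hη, κ, hκ, hηκ⟩ := Submodule.mem_sup.1 (hL p hWt)
  rw [LinearMap.mem_ker] at hκ
  have hκt : complexBetti.map (fiberι f t) (2 * p) κ = 0 := hκ
  have hκs : complexBetti.map (fiberι f s) (2 * p) κ = 0 := map_fiberι_eq_zero_of_eq_zero hf hκt s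
  have hWs : complexBetti.map (fiberι f s) (2 * p) W = complexBetti.map (fiberι f s) (2 * p) η := by
    rw [← hηκ, map_add, hκs, add_zero]
  rw [hWs]
  haveI : IrreducibleSpace S.left := Andre1996.compactPencil_irreducibleSpace_base hf
  haveI := Andre1996.compactPencil_smooth_base hf
  exact map_fiberι_mem_algebraicClasses f hf.isSmoothProjectiveFamily
    (IsQuasiProjectiveOver.of_isProjectiveOver hf.isSmoothProjective_base.isProjectiveOver) hη s

/-- **(IHC_f) ⟹ the lift at EVERY point, granted `SpreadCurve[]`** (no `HC_CM`): a class `W` with `j_t^* W`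
algebraic lies in the `ℂ`-span of RATIONAL such classes (part XVII-b); a rational one has rational `(p,p)` fibre
restrictions (part XVII-a), is algebraic on every fibre by (IHC_f), and is lifted by part XIX-a's engine. Part
XIX-c's `comap_le_sup_of_hcAtDim` is the case (IHC_f) ⟸ `HCAtDim d`.
[cite: VoisinHodgeII2003, §3.3.1 and §10.2.1, proof of Thm. 10.19] [cite: CharlesSchnell2014Notes, Prop. 11.3.5] -/
theorem comap_le_sup_of_forall_mem_algebraicClasses (hSp : SpreadCurve[]) {d : ℕ} {f : 𝒳 ⟶ S}
    (hf : IsCompactAbelianPencil f d)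
    (h : ∀ (p : ℕ) (W : complexBetti 𝒳 (2 * p)),
      (∀ s : ComplexPoints S, IsRationalClass (complexBetti.map (fiberι f s) (2 * p) W) ∧
        IsOfHodgeType d (fiberOver f s) (2 * p) p p (complexBetti.map (fiberι f s) (2 * p) W)) →
      ∀ s : ComplexPoints S, complexBetti.map (fiberι f s) (2 * p) W ∈ algebraicClasses (fiberOver f s) p)
    (p : ℕ) (t : ComplexPoints S) :
    (algebraicClasses (fiberOver f t) p).comap (complexBetti.map (fiberι f t) (2 * p)).hom ≤
      algebraicClasses 𝒳 p ⊔ LinearMap.ker (complexBetti.map (fiberι f t) (2 * p)).hom := by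
  intro W hW
  have hW' : complexBetti.map (fiberι f t) (2 * p) W ∈ algebraicClasses (fiberOver f t) p := hW
  have hspan := mem_span_rational_of_map_fiberι_mem_algebraicClasses hf hW'
  have hle : Submodule.span ℂ {W' : complexBetti 𝒳 (2 * p) | IsRationalClass W' ∧
      complexBetti.map (fiberι f t) (2 * p) W' ∈ algebraicClasses (fiberOver f t) p} ≤
      algebraicClasses 𝒳 p ⊔ LinearMap.ker (complexBetti.map (fiberι f t) (2 * p)).hom := by
    refine Submodule.span_le.2 ?_
    rintro W' ⟨hW'rat, hW'alg⟩
    have hbind := fibrewiseHodge_of_isRationalClass_of_mem_algebraicClasses hf hW'rat hW'alg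
    obtain ⟨η, hη, hηW'⟩ := exists_algebraic_lift_of_forall_mem_algebraicClasses hSp hf W'
      (fun s ↦ (hbind s).1) (h p W' hbind)
    change W' ∈ algebraicClasses 𝒳 p ⊔ LinearMap.ker (complexBetti.map (fiberι f t) (2 * p)).hom
    rw [show W' = η + (W' - η) by abel]
    refine Submodule.add_mem_sup hη ?_
    rw [LinearMap.mem_ker, map_sub, sub_eq_zero]
    exact (hηW' t).symm
  exact hle hspan

/-! ## §2 The four statements coincide at a CM point, granted `HC_CM` and spreading -/

/-- **PENCIL BY PENCIL, at a CM point `t`, granted `HC_CM` and `SpreadCurve[]`: (1.1)_f ⟺ (IHC_f)**.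
`HC_CM` a BINDER. [cite: Abdulali1994FamiliesAV, (1.1) (p. 1122) and Lemma 6.2 (p. 1131)] -/
theorem invariantCyclesHoldFor_iff_forall_mem_algebraicClasses_of_HC_CM (hCM : RankFourFaces.CMAbelianHodge)
    {d : ℕ} {f : 𝒳 ⟶ S} {t : ComplexPoints S} (ht : t ∈ cmLocus f d) :
    InvariantCyclesHoldFor f d ↔
      ∀ (p : ℕ) (W : complexBetti 𝒳 (2 * p)),
        (∀ s : ComplexPoints S, IsRationalClass (complexBetti.map (fiberι f s) (2 * p) W) ∧
          IsOfHodgeType d (fiberOver f s) (2 * p) p p (complexBetti.map (fiberι f s) (2 * p) W)) →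
        ∀ s : ComplexPoints S, complexBetti.map (fiberι f s) (2 * p) W ∈ algebraicClasses (fiberOver f s) p :=
  ⟨fun hT p W hW s ↦ forall_mem_algebraicClasses_of_invariantCyclesHoldFor_of_HC_CM hCM ht hT p W hW s,
    invariantCyclesHoldFor_of_forall_mem_algebraicClasses⟩

/-- **PENCIL BY PENCIL, at a CM point `t`, granted `HC_CM` and `SpreadCurve[]`: the lift at `t` in every
codimension ⟺ (IHC_f).** [cite: Milne2020HodgeClassesAV, Prop. 1 (p. 7)] [cite: VoisinHodgeII2003, §3.3.1] -/
theorem comap_le_sup_iff_forall_mem_algebraicClasses_of_HC_CM (hCM : RankFourFaces.CMAbelianHodge)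
    (hSp : SpreadCurve[]) {d : ℕ} {f : 𝒳 ⟶ S} (hf : IsCompactAbelianPencil f d) {t : ComplexPoints S}
    (ht : t ∈ cmLocus f d) :
    (∀ p : ℕ, (algebraicClasses (fiberOver f t) p).comap (complexBetti.map (fiberι f t) (2 * p)).hom ≤
      algebraicClasses 𝒳 p ⊔ LinearMap.ker (complexBetti.map (fiberι f t) (2 * p)).hom) ↔
      ∀ (p : ℕ) (W : complexBetti 𝒳 (2 * p)),
        (∀ s : ComplexPoints S, IsRationalClass (complexBetti.map (fiberι f s) (2 * p) W) ∧
          IsOfHodgeType d (fiberOver f s) (2 * p) p p (complexBetti.map (fiberι f s) (2 * p) W)) →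
        ∀ s : ComplexPoints S, complexBetti.map (fiberι f s) (2 * p) W ∈ algebraicClasses (fiberOver f s) p :=
  ⟨fun hL p W hW s ↦ forall_mem_algebraicClasses_of_comap_le_sup_of_HC_CM hCM hf ht hL p W hW s,
    fun h p ↦ comap_le_sup_of_forall_mem_algebraicClasses hSp hf h p t⟩

/-- **PENCIL BY PENCIL, at a CM point `t`, granted `HC_CM` and `SpreadCurve[]`: CONJECTURE D FOR THE CYCLES OF THE
TOTAL SPACE SUPPORTED ON THE CM FIBRE ⟺ ABDULALI'S TRANSPORT ON THIS PENCIL** — `(∀ p + q = d, (Num_t)(p,q)) ⟺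
InvariantCyclesHoldFor f d` ((Num_t) ⟺ (L)_t by part XVIII-c; (L)_t ⟺ (IHC_f) ⟺ (1.1)_f by §1–§2). The pencilwise
form of parts XIX-a/b's node-level exactness; the form habitat rows consume: on a CM-pointed pencil of Weil-type
abelian sixfolds the right-hand side contains the algebraicity of the invariant Weil classes on every member.
`HC_CM` a BINDER. [cite: Kleiman1968AlgebraicCycles, §3 (D(X))] [cite: Abdulali1994FamiliesAV, (1.1) (p. 1122)]
[cite: VoisinHodgeII2003, §3.3.1 and §10.2.1, proof of Thm. 10.19] -/
theorem numerical_iff_invariantCyclesHoldFor_of_HC_CM (hCM : RankFourFaces.CMAbelianHodge) (hSp : SpreadCurve[])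
    {d : ℕ} {f : 𝒳 ⟶ S} (hf : IsCompactAbelianPencil f d) {t : ComplexPoints S} (ht : t ∈ cmLocus f d) :
    (∀ (p q : ℕ) (hpq : p + q = d), ∀ b ∈ algebraicClasses (fiberOver f t) q,
      (∀ a ∈ algebraicClasses 𝒳 p,
        cupProduct (show 2 * p + 2 * (q + 1) = 2 * (d + 1) by omega) a (fiberGysin hf t q b) = 0) →
        fiberGysin hf t q b = 0) ↔
      InvariantCyclesHoldFor f d := by
  rw [invariantCyclesHoldFor_iff_forall_mem_algebraicClasses_of_HC_CM hCM ht,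
    ← comap_le_sup_iff_forall_mem_algebraicClasses_of_HC_CM hCM hSp hf ht]
  refine ⟨fun h p ↦ ?_, fun h p q hpq ↦ (numerical_iff_comap_le_sup_of_HC_CM hCM hf ht hpq).2 (h p)⟩
  rcases le_or_gt p d with hp | hp
  · exact (numerical_iff_comap_le_sup_of_HC_CM hCM hf ht (show p + (d - p) = d by omega)).1 (h p (d - p) (by omega))
  · haveI := subsingleton_complexBetti (hf.isSmoothProjective_fiberOver t) (show 2 * d < 2 * p by omega)
    intro W _
    refine Submodule.mem_sup_right ?_
    rw [LinearMap.mem_ker]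
    exact Subsingleton.elim _ _

/-- **The find-the-cycle form, pencil by pencil**: at a CM point `t` of a compact pencil of abelian `d`-folds,
granted `HC_CM` and `SpreadCurve[]`, the following are equivalent: (a) every algebraic `b` on the CM fibre with
`j_{t*} b ≠ 0` is detected by an algebraic class of the total space (`∃ a ∈ N^p(𝒳)`, `j_t^* a ∪ b ≠ 0`, all
`p + q = d`); (b) every global class with rational `(p,p)` fibre restrictions is algebraic on EVERY fibre. So the
`(d+1)`-fold cycle problem of RING2-MAP AA2.79 and the fibrewise algebraicity problem are ONE problem per pencil.
[cite: Kleiman1968AlgebraicCycles, §3 (D(X))] [cite: Andre1996Motifs, §6.3 Remarque 2 (p. 33)] -/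
theorem detect_iff_forall_mem_algebraicClasses_of_HC_CM (hCM : RankFourFaces.CMAbelianHodge) (hSp : SpreadCurve[])
    {d : ℕ} {f : 𝒳 ⟶ S} (hf : IsCompactAbelianPencil f d) {t : ComplexPoints S} (ht : t ∈ cmLocus f d) :
    (∀ (p q : ℕ) (hpq : p + q = d), ∀ b ∈ algebraicClasses (fiberOver f t) q, fiberGysin hf t q b ≠ 0 →
      ∃ a ∈ algebraicClasses 𝒳 p,
        cupProduct (show 2 * p + 2 * q = 2 * d by omega) (complexBetti.map (fiberι f t) (2 * p) a) b ≠ 0) ↔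
      ∀ (p : ℕ) (W : complexBetti 𝒳 (2 * p)),
        (∀ s : ComplexPoints S, IsRationalClass (complexBetti.map (fiberι f s) (2 * p) W) ∧
          IsOfHodgeType d (fiberOver f s) (2 * p) p p (complexBetti.map (fiberι f s) (2 * p) W)) →
        ∀ s : ComplexPoints S, complexBetti.map (fiberι f s) (2 * p) W ∈ algebraicClasses (fiberOver f s) p := by
  rw [← invariantCyclesHoldFor_iff_forall_mem_algebraicClasses_of_HC_CM hCM ht,
    ← numerical_iff_invariantCyclesHoldFor_of_HC_CM hCM hSp hf ht]
  exact forall₃_congr fun p q hpq ↦ (numerical_iff_detect hf t hpq).symm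

end Summit.HodgeConjecture.HodgeConjecture.Ring2.AbelianAll

end
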